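import Literature.Analysis.OperatorTheory.Enflo2023.Basic
import Literature.Analysis.OperatorTheory.Enflo2023.Reductions
import Literature.Analysis.OperatorTheory.Enflo2023.NormalCase
import Literature.Analysis.OperatorTheory.Enflo2023.CompactCommutant
import Literature.Analysis.Convex.SchauderFixedPoint
import HarnessLib

/-!
# Enflo 2023, repair census: LOMONOSOV'S THEOREM (row R8, second clause, full strength) — closed in Lean via the
# tree's Schauder fixed-point theorem, outside the mechanism

Source under adjudication: Per H. Enflo, *On the invariant subspace problem in Hilbert spaces*, arXiv:2305.15442 (v1
2023, v2 2024), bib key `Enflo2023` — a CLAIMED proof of the invariant subspace problem for operators on a separable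
Hilbert space.  This file is part of the kernel-tight typing of the manuscript by the b2b-enflo repair cell
(formaliser 2, Part B: (28)–(47), the limiting argument and the final deduction).  It records what FOLLOWS (proved
implications from the manuscript's displayed hypotheses) and, where a step does not follow, the typed inference
together with its refutation.  NOTHING here asserts that the manuscript's main theorem holds; no declaration concludes
the invariant subspace problem for an arbitrary operator.  Value (BLOCK-2b): theorems / refutations of typed
inferences about a text — not progress on the problem.

REPAIR-CENSUS row R8, THEOREM column, Lomonosov's clause at full strength.  `CompactCommutant.lean` closed "`T`
commutes with a non-zero compact operator" through Hilden's fixed-point-free proof of the hyperinvariant-subspace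
theorem for COMPACT operators (Radjavi–Rosenthal 1973, Cor. 8.25).  Lomonosov's 1973 theorem is stronger: a
NON-SCALAR operator commuting with a non-zero compact operator has a non-trivial closed HYPERINVARIANT subspace
(Radjavi–Rosenthal, Thm. 8.23), hence every operator commuting with a non-scalar operator that commutes with a non-zero
compact operator has a non-trivial closed invariant subspace [cite: Lomonosov1973] [cite: RadjaviRosenthal1973, Thm. 8.23].
Its proof goes through LOMONOSOV'S LEMMA (ibid. Lemma 8.22), whose engine is the Schauder fixed-point theorem — which
the tree holds (`Literature.Analysis.Convex.exists_fixedPoint_of_mapsTo_isCompact`, file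
`Literature/Analysis/Convex/SchauderFixedPoint.lean`).  This file carries the proof out:

* `finiteDimensional_ker_sub_one_of_isCompactOperator` — the fixed space `ker (C − 1)` of a compact `C` is
  finite-dimensional (the restriction of `C` to it is the identity and compact: Mathlib `IsCompactOperator.restrict`,
  `FiniteDimensional.of_isCompactOperator_id`);
* `exists_commute_apply_eq_self_of_dense_commutantOrbit` — **LOMONOSOV'S LEMMA** for the commutant of `T`: if every
  non-zero vector has a dense orbit under `{T}'` (`commutantOrbit`, `CompactCommutant.lean`) and `K ≠ 0` is compact, then
  some `A ∈ {T}'` has `A K x = x` for a vector `x ≠ 0`.  Proof as printed (R–R pp. 159–160): `x₀` with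
  `‖K x₀‖ = ‖K‖ + 1`, the ball `B = closedBall x₀ 1` (`‖K z‖ ≥ 1`, `‖z‖ ≥ ‖x₀‖ − 1 > 0` on `B`), the compact set
  `S = closure (K '' B) ∌ 0`, a finite subcover of `S` by `Aᵢ⁻¹(ball x₀ 1)` (density of the orbits), the partition of
  unity `wᵢ(y) = max (0, 1 − ‖Aᵢ y − x₀‖)` and the LOMONOSOV MAP `Ψ(z) = (Σ wᵢ(Kz))⁻¹ Σ wᵢ(Kz) Aᵢ K z`
  (`Finset.centerMass`): continuous on `B`, `Ψ(B) ⊆ B` (convexity of `B`), `Ψ(B)` inside the compact set `Φ(S)`;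
  Schauder gives `Ψ x = x`, `x ∈ B`, and `A = Σ aᵢ Aᵢ` with the weights frozen at `x` is in `{T}'` with `A K x = x`;
* `exists_hyperinvariant_of_commute_isCompactOperator` — **R–R Thm. 8.23**: `T` non-scalar, `K ≠ 0` compact,
  `T K = K T` ⇒ a closed `M`, `⊥ ≠ M ≠ ⊤`, invariant under every `S` commuting with `T`.  (If not, the orbits are dense;
  the Lemma gives `A`; `C = A K` is compact and commutes with `T`, so `E = ker (C − 1) ∋ x` is finite-dimensional,
  non-zero and `T`-invariant; `T|_E` has an eigenvalue `μ` (Mathlib `Module.End.exists_eigenvalue`), and `ker (T − μ)` is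
  the hyperinvariant subspace — `exists_hyperinvariant_of_hasEigenvalue`, `CompactCommutant.lean`.)
* `hasNontrivialClosedInvariantSubspace_of_commute_of_commute_isCompactOperator` — **LOMONOSOV'S THEOREM**: `T`
  commuting with a non-scalar `S` that commutes with a non-zero compact `K` has a non-trivial closed invariant
  subspace; NO hypothesis on the dimension, completeness or separability of `H` is needed.

Reading for the census.  As for R8/R9/R12 it is NOT the manuscript's mechanism (norm convergence of the MC outputs, the
room claim of v2 p.20 — refuted with every standing hypothesis in `RoomClaimT.lean`, row R13) that proves the theorem in
Lomonosov's class: the Schauder fixed point does, and no Main-Construction data is needed at all.  What stays open as a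
THEOREM is row R10 (essentially normal `T = N + K`) and the general operator.  The results here are classical (1973) and
not claimed new.
Origin: planner-b2b-enflo-2-g4-0 (formaliser 2, gen-4), 2026-08-18.  Tree: Schauder (`Literature.Analysis.Convex`);
Mathlib: compact operators, `Finset.centerMass`, eigenvalues in finite dimension.
-/

open scoped InnerProductSpace
open Filter Topology Set

namespace Literature.Analysis.OperatorTheory.Enflo2023

variable {H : Type*} [NormedAddCommGroup H] [InnerProductSpace ℂ H]

/-! ### The fixed space of a compact operator is finite-dimensional -/

/-- For a compact operator `C`, the closed subspace `ker (C − 1)` (on which `C` is the identity) is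
finite-dimensional: the restriction of `C` to it is a compact identity map (Riesz). [folklore] -/
lemma finiteDimensional_ker_sub_one_of_isCompactOperator (C : H →L[ℂ] H) (hC : IsCompactOperator C) :
    FiniteDimensional ℂ (LinearMap.ker ((C - 1 : H →L[ℂ] H) : H →ₗ[ℂ] H)) := by
  set E := LinearMap.ker ((C - 1 : H →L[ℂ] H) : H →ₗ[ℂ] H) with hE
  have hmem : ∀ v : H, v ∈ E ↔ C v = v := fun v => by
    simp [hE, sub_eq_zero]
  have hCE : ∀ v ∈ E, (C : H →ₗ[ℂ] H) v ∈ E := fun v hv => by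
    rw [ContinuousLinearMap.coe_coe, (hmem v).1 hv]
    exact hv
  have hres : IsCompactOperator ((C : H →ₗ[ℂ] H).restrict hCE) :=
    hC.restrict hCE ((C - 1 : H →L[ℂ] H).isClosed_ker)
  have hid : (((C : H →ₗ[ℂ] H).restrict hCE : E →ₗ[ℂ] E) : E → E) = id := by
    funext v
    apply Subtype.ext
    simp only [id, LinearMap.coe_restrict_apply, ContinuousLinearMap.coe_coe]
    exact (hmem v).1 v.2
  rw [hid] at hres
  exact FiniteDimensional.of_isCompactOperator_id (𝕜 := ℂ) hres

/-! ### Lomonosov's Lemma (via the tree's Schauder fixed-point theorem) -/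

/-- **Lomonosov's Lemma** (Radjavi–Rosenthal 1973, Lemma 8.22, for the algebra `{T}'`).  If every non-zero vector has a
dense orbit under the commutant of `T` and `K ≠ 0` is compact, then there are `A` commuting with `T` and `x ≠ 0` with
`A (K x) = x`.  Proof: Schauder's fixed-point theorem (`Literature.Analysis.Convex.exists_fixedPoint_of_mapsTo_isCompact`)
applied to the Lomonosov map `Ψ z = Σᵢ (wᵢ(Kz)/Σⱼwⱼ(Kz)) Aᵢ K z` on the ball `B = closedBall x₀ 1`, where the `Aᵢ` come
from a finite subcover of the compact set `closure (K '' B)` by `Aᵢ⁻¹(ball x₀ 1)` and `wᵢ(y) = max (0, 1 − ‖Aᵢy − x₀‖)`.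
[cite: RadjaviRosenthal1973, Lemma 8.22] -/
theorem exists_commute_apply_eq_self_of_dense_commutantOrbit (T K : H →L[ℂ] H) (hK : IsCompactOperator K)
    (hK0 : K ≠ 0) (hdense : ∀ y : H, y ≠ 0 → Dense (commutantOrbit T y : Set H)) :
    ∃ A : H →L[ℂ] H, Commute A T ∧ ∃ x : H, x ≠ 0 ∧ A (K x) = x := by
  classical
  -- a vector on which `K` does not vanish, rescaled so that `‖K x₀‖ = ‖K‖ + 1`
  obtain ⟨x₁, hx₁⟩ : ∃ x : H, K x ≠ 0 := by
    by_contra h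
    push Not at h
    exact hK0 (ContinuousLinearMap.ext fun x => by simpa using h x)
  have hKx₁ : 0 < ‖K x₁‖ := norm_pos_iff.mpr hx₁
  have hKpos : 0 < ‖K‖ := norm_pos_iff.mpr hK0
  set t : ℝ := (‖K‖ + 1) / ‖K x₁‖ with ht
  have ht0 : 0 < t := by positivity
  set x₀ : H := (t : ℂ) • x₁ with hx₀def
  have hKx₀ : ‖K x₀‖ = ‖K‖ + 1 := by
    rw [hx₀def, map_smul, norm_smul, Complex.norm_real, Real.norm_of_nonneg ht0.le, ht,
      div_mul_cancel₀ _ hKx₁.ne']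
  have hx₀gt : 1 < ‖x₀‖ := by
    by_contra hle
    push Not at hle
    have h1 : ‖K‖ + 1 ≤ ‖K‖ * ‖x₀‖ := hKx₀ ▸ K.le_opNorm x₀
    have h2 : ‖K‖ * ‖x₀‖ ≤ ‖K‖ * 1 := by gcongr
    linarith
  -- the ball `B` and the two estimates on it
  set B : Set H := Metric.closedBall x₀ 1 with hB
  have hBnorm : ∀ z ∈ B, ‖x₀‖ - 1 ≤ ‖z‖ := by
    intro z hz
    rw [hB, Metric.mem_closedBall, dist_eq_norm] at hz
    have := norm_sub_norm_le x₀ z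
    rw [← norm_neg, neg_sub] at hz
    linarith
  have hBK : ∀ z ∈ B, 1 ≤ ‖K z‖ := by
    intro z hz
    rw [hB, Metric.mem_closedBall, dist_eq_norm] at hz
    have h1 : ‖K (x₀ - z)‖ ≤ ‖K‖ * 1 := by
      refine (K.le_opNorm _).trans ?_
      gcongr
      rwa [← norm_neg, neg_sub]
    have h2 : ‖K x₀‖ - ‖K x₀ - K z‖ ≤ ‖K x₀ - (K x₀ - K z)‖ := norm_sub_norm_le _ _
    rw [sub_sub_cancel, ← map_sub] at h2
    linarith
  -- the compact set `S = closure (K '' B)`; it avoids `0`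
  have hScpt : IsCompact (closure (K '' B)) := by
    simpa only [ContinuousLinearMap.coe_coe] using
      hK.isCompact_closure_image_of_bounded (f := (K : H →ₗ[ℂ] H)) (Metric.isBounded_closedBall (x := x₀) (r := 1))
  have hSnorm : ∀ y ∈ closure (K '' B), 1 ≤ ‖y‖ := by
    have hcl : IsClosed {y : H | 1 ≤ ‖y‖} := isClosed_le continuous_const continuous_norm
    have hsub : K '' B ⊆ {y : H | 1 ≤ ‖y‖} := by
      rintro _ ⟨z, hz, rfl⟩
      exact hBK z hz
    exact fun y hy => closure_minimal hsub hcl hy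
  -- the open cover of `S` indexed by the commutant of `T`, and a finite subcover
  let ι := {A : H →L[ℂ] H // Commute A T}
  let U : ι → Set H := fun A => (A : H →L[ℂ] H) ⁻¹' Metric.ball x₀ 1
  have hUo : ∀ i, IsOpen (U i) := fun i => Metric.isOpen_ball.preimage (i : H →L[ℂ] H).continuous
  have hcov : closure (K '' B) ⊆ ⋃ i, U i := by
    intro y hy
    have hy0 : y ≠ 0 := by
      intro h
      have := hSnorm y hy
      rw [h, norm_zero] at this
      linarith
    obtain ⟨x, hxO, hxball⟩ :=
      (hdense y hy0).exists_mem_open Metric.isOpen_ball ⟨x₀, Metric.mem_ball_self one_pos⟩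
    obtain ⟨A, hA, rfl⟩ := (mem_commutantOrbit (K := T)).mp hxO
    exact Set.mem_iUnion.mpr ⟨⟨A, hA⟩, hxball⟩
  obtain ⟨tfin, htfin⟩ := hScpt.elim_finite_subcover U hUo hcov
  -- the partition of unity `wᵢ(y) = max (0, 1 - ‖Aᵢ y - x₀‖)` and its total `W`
  let w : ι → H → ℝ := fun i y => max 0 (1 - ‖(i : H →L[ℂ] H) y - x₀‖)
  have hw0 : ∀ (i : ι) (y : H), 0 ≤ w i y := fun i y => le_max_left _ _
  have hwc : ∀ i : ι, Continuous (w i) := fun i =>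
    continuous_const.max (continuous_const.sub (((i : H →L[ℂ] H).continuous.sub continuous_const).norm))
  have hwpos : ∀ (i : ι) (y : H), 0 < w i y → (i : H →L[ℂ] H) y ∈ Metric.ball x₀ 1 := by
    intro i y h
    rw [Metric.mem_ball, dist_eq_norm]
    rcases lt_max_iff.mp h with h | h
    · exact absurd h (lt_irrefl 0)
    · linarith
  have hwpos' : ∀ (i : ι) (y : H), (i : H →L[ℂ] H) y ∈ Metric.ball x₀ 1 → 0 < w i y := by
    intro i y h
    rw [Metric.mem_ball, dist_eq_norm] at h
    exact lt_max_iff.mpr (Or.inr (by linarith))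
  let W : H → ℝ := fun y => ∑ i ∈ tfin, w i y
  have hWc : Continuous W := continuous_finsetSum _ fun i _ => hwc i
  have hWS : ∀ y ∈ closure (K '' B), 0 < W y := by
    intro y hy
    obtain ⟨i, hi, hiy⟩ := Set.mem_iUnion₂.mp (htfin hy)
    exact Finset.sum_pos' (fun j _ => hw0 j y) ⟨i, hi, hwpos' i y hiy⟩
  -- the Lomonosov map `Φ` (on `S`) and `Ψ = Φ ∘ K` (on `B`)
  let Φ : H → H := fun y => tfin.centerMass (fun i => w i y) (fun i => (i : H →L[ℂ] H) y)
  have hΦc : ContinuousOn Φ {y | 0 < W y} := by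
    have h1 : Continuous fun y : H => ∑ i ∈ tfin, w i y • (i : H →L[ℂ] H) y :=
      continuous_finsetSum _ fun i _ => (hwc i).smul (i : H →L[ℂ] H).continuous
    have h2 : ContinuousOn (fun y : H => (W y)⁻¹) {y | 0 < W y} :=
      hWc.continuousOn.inv₀ fun y hy => ne_of_gt hy
    exact h2.smul h1.continuousOn
  have hΦB : ∀ y ∈ closure (K '' B), Φ y ∈ B := by
    intro y hy
    have hfilt : Φ y = (tfin.filter fun i => w i y ≠ 0).centerMass (fun i => w i y)
        (fun i => (i : H →L[ℂ] H) y) :=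
      (Finset.centerMass_filter_ne_zero (t := tfin) (w := fun i => w i y) (z := fun i => (i : H →L[ℂ] H) y)).symm
    rw [hfilt, hB]
    refine (convex_closedBall x₀ 1).centerMass_mem (fun i _ => hw0 i y) ?_ ?_
    · rw [Finset.sum_filter_ne_zero]
      exact hWS y hy
    · intro i hi
      rw [Finset.mem_filter] at hi
      have hpos : 0 < w i y := lt_of_le_of_ne (hw0 i y) (Ne.symm hi.2)
      exact Metric.ball_subset_closedBall (hwpos i y hpos)
  have hKS : ∀ z ∈ B, K z ∈ closure (K '' B) := fun z hz => subset_closure ⟨z, hz, rfl⟩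
  let Ψ : H → H := Φ ∘ K
  have hΨc : ContinuousOn Ψ B :=
    hΦc.comp K.continuous.continuousOn fun z hz => hWS _ (hKS z hz)
  have hΨB : MapsTo Ψ B B := fun z hz => hΦB _ (hKS z hz)
  have hΦScpt : IsCompact (Φ '' closure (K '' B)) :=
    hScpt.image_of_continuousOn (hΦc.mono fun y hy => hWS y hy)
  have hΨS : MapsTo Ψ B (Φ '' closure (K '' B)) := fun z hz => ⟨K z, hKS z hz, rfl⟩
  -- Schauder's fixed-point theorem on the closed convex set `B`
  obtain ⟨x, hxB, hx⟩ := Literature.Analysis.Convex.exists_fixedPoint_of_mapsTo_isCompact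
    (convex_closedBall x₀ 1) Metric.isClosed_closedBall ⟨x₀, Metric.mem_closedBall_self zero_le_one⟩
    hΦScpt hΨc hΨB hΨS
  -- the operator `A = Σ aᵢ Aᵢ` with the weights frozen at the fixed point
  refine ⟨∑ i ∈ tfin, ((((∑ j ∈ tfin, w j (K x))⁻¹ * w i (K x) : ℝ) : ℂ)) • (i : H →L[ℂ] H),
    Commute.sum_left _ _ _ fun i _ => (i.2).smul_left _, x, ?_, ?_⟩
  · intro h0
    have := hBnorm x hxB
    rw [h0, norm_zero] at this
    linarith
  · have hAx : (∑ i ∈ tfin, ((((∑ j ∈ tfin, w j (K x))⁻¹ * w i (K x) : ℝ) : ℂ)) • (i : H →L[ℂ] H)) (K x)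
        = Ψ x := by
      simp only [Ψ, Φ, Function.comp, Finset.centerMass, FunLike.coe_sum, Finset.sum_apply,
        FunLike.coe_smul, Pi.smul_apply, Complex.coe_smul, Finset.smul_sum, smul_smul]
    rw [hAx, hx]

/-! ### Lomonosov's theorem -/

/-- **Radjavi–Rosenthal Thm. 8.23 (Lomonosov 1973): a NON-SCALAR operator `T` commuting with a non-zero compact operator
`K` has a non-trivial closed hyperinvariant subspace.**  If not, every non-zero vector has a dense `{T}'`-orbit
(`dense_commutantOrbit_of_no_hyperinvariant`); Lomonosov's Lemma gives `A ∈ {T}'` and `x ≠ 0` with `A K x = x`; `C = A K`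
is compact and commutes with `T`, so `E = ker (C − 1)` is a finite-dimensional, non-zero, `T`-invariant subspace; an
eigenvalue `μ` of `T|_E` makes `ker (T − μ)` hyperinvariant, closed, `≠ ⊥`, and `≠ ⊤` because `T ≠ μ`.  No completeness,
separability or dimension hypothesis. [cite: RadjaviRosenthal1973, Thm. 8.23] -/
theorem exists_hyperinvariant_of_commute_isCompactOperator (T K : H →L[ℂ] H) (hK : IsCompactOperator K)
    (hK0 : K ≠ 0) (hTK : Commute T K) (hT : ∀ c : ℂ, T ≠ c • (1 : H →L[ℂ] H)) :
    ∃ M : Submodule ℂ H, IsClosed (M : Set H) ∧ M ≠ ⊥ ∧ M ≠ ⊤ ∧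
      ∀ S : H →L[ℂ] H, Commute S T → IsInvariant S M := by
  by_contra hno
  push Not at hno
  have hdense : ∀ y : H, y ≠ 0 → Dense (commutantOrbit T y : Set H) :=
    fun y hy => dense_commutantOrbit_of_no_hyperinvariant hno hy
  obtain ⟨A, hAT, x, hx0, hAKx⟩ := exists_commute_apply_eq_self_of_dense_commutantOrbit T K hK hK0 hdense
  -- `C = A K`: compact, commutes with `T`, fixes `x`
  set C : H →L[ℂ] H := A * K with hC
  have hCc : IsCompactOperator C := hK.clm_comp A
  have hTC : Commute T C := hAT.symm.mul_right hTK
  set E := LinearMap.ker ((C - 1 : H →L[ℂ] H) : H →ₗ[ℂ] H) with hE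
  have hmemE : ∀ v : H, v ∈ E ↔ C v = v := fun v => by
    simp [hE, sub_eq_zero]
  have hxE : x ∈ E := (hmemE x).2 (by rw [hC]; exact hAKx)
  haveI : FiniteDimensional ℂ E := finiteDimensional_ker_sub_one_of_isCompactOperator C hCc
  have hTE : ∀ v ∈ E, (T : H →ₗ[ℂ] H) v ∈ E := fun v hv =>
    isInvariant_ker_of_commute T (C - 1) (hTC.sub_right (Commute.one_right T)) v hv
  haveI : Nontrivial E :=
    ⟨⟨⟨x, hxE⟩, 0, fun h => hx0 (by simpa using congrArg Subtype.val h)⟩⟩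
  obtain ⟨μ, hμ⟩ := Module.End.exists_eigenvalue ((T : H →ₗ[ℂ] H).restrict hTE)
  obtain ⟨v, hv⟩ := hμ.exists_hasEigenvector
  have hTv : T (v : H) = μ • (v : H) := by
    have e := congrArg Subtype.val hv.apply_eq_smul
    simpa using e
  have hv0 : (v : H) ≠ 0 := fun h => hv.2 (Submodule.coe_eq_zero.mp h)
  have hev : Module.End.HasEigenvalue (T : Module.End ℂ H) μ :=
    Module.End.hasEigenvalue_of_hasEigenvector
      (⟨Module.End.mem_eigenspace_iff.mpr hTv, hv0⟩ : Module.End.HasEigenvector (T : Module.End ℂ H) μ (v : H))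
  obtain ⟨M, hMc, hMb, hMt, hMi⟩ := exists_hyperinvariant_of_hasEigenvalue T hev (hT μ)
  obtain ⟨S, hS, hSM⟩ := hno M hMc hMb hMt
  exact hSM (hMi S hS)

/-- **LOMONOSOV'S THEOREM (1973)**, census R8 second clause at full strength: if `T` commutes with a NON-SCALAR operator
`S` which commutes with a non-zero compact operator `K`, then `T` has a non-trivial closed invariant subspace — a
hyperinvariant subspace of `S`.  No hypothesis on `H` (a non-scalar `S` forces `dim H ≥ 2`); no Main-Construction data,
no room claim: the manuscript's mechanism plays no role. [cite: Lomonosov1973] -/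
theorem hasNontrivialClosedInvariantSubspace_of_commute_of_commute_isCompactOperator (T S K : H →L[ℂ] H)
    (hK : IsCompactOperator K) (hK0 : K ≠ 0) (hSK : Commute S K) (hS : ∀ c : ℂ, S ≠ c • (1 : H →L[ℂ] H))
    (hTS : Commute T S) : HasNontrivialClosedInvariantSubspace T := by
  obtain ⟨M, hMc, hMb, hMt, hMi⟩ := exists_hyperinvariant_of_commute_isCompactOperator S K hK hK0 hSK hS
  exact ⟨M, hMc, hMb, hMt, hMi T hTS⟩

/-- The case `S = T` of Lomonosov's theorem: a non-scalar operator commuting with a non-zero compact operator has a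
non-trivial closed invariant (indeed hyperinvariant) subspace; with `CompactCommutant.lean`'s eigenline for scalar `T`
this is again census R8, second clause, now WITHOUT the detour through `σ(K)`. [cite: RadjaviRosenthal1973, Thm. 8.23] -/
theorem hasNontrivialClosedInvariantSubspace_of_commute_isCompactOperator' (T K : H →L[ℂ] H)
    (hK : IsCompactOperator K) (hK0 : K ≠ 0) (hTK : Commute T K) (hT : ∀ c : ℂ, T ≠ c • (1 : H →L[ℂ] H)) :
    HasNontrivialClosedInvariantSubspace T :=
  hasNontrivialClosedInvariantSubspace_of_commute_of_commute_isCompactOperator T T K hK hK0 hTK hT (Commute.refl T)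

end Literature.Analysis.OperatorTheory.Enflo2023
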